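import Mathlib
import HarnessLib
import Summits.ValiantsHypothesis.ValiantsHypothesis.Theorems.LacunarySymmetroidMatrixDescartesOsculationLawUniformDictionary

/-!
# ValiantsHypothesis / LacunarySymmetroid — crux `MatrixDescartes` (stmt-ValiantsHypothesis-18050, V1),
# line «osculation-law»: UNIFORM columns, part 9 — LINE-GENERICITY of «osculation set finite»: along a polynomial
# one-parameter family of bivariate curves, the resultant criterion fails for at most finitely many parameters

Data: `Φh : MvPolynomial (Fin 2) ℝ[X]` — a bivariate polynomial whose coefficients are polynomials in a parameter `ε`
(e.g. the node curves of the `stub_recursion` density argument along the segment `S_ε = (1−ε)S + εW`: node 1 is affine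
in `ε`, node 2 is `det(G_ε(t) − c tᴺ + b·(S_{K,ε} + c·1))`, polynomial in `ε` for fixed `c`); `Φ_ε := MvPolynomial.map
(evalRingHom ε) Φh`.  With `toBiv` (part 8, inline `MvPolynomial.aeval ![C X, X]`) and the bordered log-Hessian `H`:
* naturality: `toBiv Φ_ε = (toBiv Φh).map (mapRingHom (evalRingHom ε))` (`toBiv_map`), `H(Φ_ε) = map (H Φh)` (`logH_map`);
* `Res_b(toBiv Φ_ε, toBiv H(Φ_ε))` with FIXED formal degrees `N, M` is the specialisation at `ε` of ONE polynomial
  `R̂ ∈ ℝ[ε][t]` (`resultant_map_map`), so it vanishes identically in `t` for at most finitely many `ε` as soon as it does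
  not at one `ε₁` (`finite_setOf_map_eval_eq_zero`); formal versus actual degrees: `resultant_ne_zero_of_formal`,
  `resultant_formal_ne_zero`;
* ★ `finite_bad_eps_resultant`: if at ONE parameter `ε₁` the curve has exact `b`-degree `N` and
  `Res_b(toBiv Φ_{ε₁}, toBiv H(Φ_{ε₁})) ≠ 0`, then `{ε | Res_b(toBiv Φ_ε, toBiv H(Φ_ε)) = 0}` is finite — combine with part 8's
  `mv_osc_finite_of_resultant_ne_zero` to get «`{Φ_ε = 0, H(Φ_ε) = 0} ∩ quadrant` finite for all but finitely many `ε`»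
  (`finite_bad_eps_osc`, given the no-vertical-fibre condition at the good `ε`);
* the WITNESS side: `Res_b(P, Q) ≢ 0` as soon as at one abscissa `t₀` the top `b`-coefficient of `P` survives, `P(t₀,·)`
  splits over `ℝ` and shares no root with `Q(t₀,·)` (`resultant_ne_zero_of_fibre`, `…_fibre'`; over `ℝ` a split polynomial
  with no common ROOT with `g` is coprime to `g`, `isCoprime_of_splits_of_no_common_root`).

Honest framing: helper layer (general-position density tools for the OPEN stub `stub_recursion` of an UNREGISTERED-law V1
line); `stub_osculationLaw` (LAW), `MatrixDescartes`, Conjecture B and `VP ≠ VNP` are OPEN / NOT proved.  No definitions, no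
named facts; Mathlib + tree files.
-/

-- `Summit.ValiantsHypothesis.ValiantsHypothesis.…` is the tree's mandated single-conjunct layout (Sub = Summit).
set_option linter.dupNamespace false

noncomputable section

namespace Summit.ValiantsHypothesis.ValiantsHypothesis.Theorems.LacunarySymmetroidMatrixDescartes

namespace OsculationUniform

open Polynomial Set
open scoped BigOperators

/-! ### Naturality in the parameter -/

/-- `toBiv` commutes with specialising the parameter. [folklore] -/
theorem toBiv_map {A : Type*} [CommRing A] (Φh : MvPolynomial (Fin 2) A) (φ : A →+* ℝ) :
    MvPolynomial.aeval (![Polynomial.C Polynomial.X, Polynomial.X] : Fin 2 → ℝ[X][X]) (MvPolynomial.map φ Φh) = (MvPolynomial.aeval (![Polynomial.C Polynomial.X, Polynomial.X] : Fin 2 → A[X][X]) Φh).map (mapRingHom φ) := by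
  set F : MvPolynomial (Fin 2) A →+* ℝ[X][X] :=
    (MvPolynomial.aeval (![Polynomial.C Polynomial.X, Polynomial.X] : Fin 2 → ℝ[X][X])).toRingHom.comp (MvPolynomial.map φ) with hF
  set G : MvPolynomial (Fin 2) A →+* ℝ[X][X] :=
    (mapRingHom (mapRingHom φ)).comp (MvPolynomial.aeval (![Polynomial.C Polynomial.X, Polynomial.X] : Fin 2 → A[X][X])).toRingHom with hG
  have hFG : F = G := by
    refine MvPolynomial.ringHom_ext (fun a => ?_) (fun i => ?_)
    · simp [hF, hG, Polynomial.algebraMap_eq]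
    · fin_cases i <;> simp [hF, hG]
  have := congr_arg (fun ψ : MvPolynomial (Fin 2) A →+* ℝ[X][X] => ψ Φh) hFG
  simpa [hF, hG] using this

/-- `θ_i` commutes with specialising the parameter. [folklore] -/
theorem euler_map {A : Type*} [CommRing A] (Ψ : MvPolynomial (Fin 2) A) (φ : A →+* ℝ) (i : Fin 2) :
    MvPolynomial.X i * MvPolynomial.pderiv i (MvPolynomial.map φ Ψ) =
      MvPolynomial.map φ (MvPolynomial.X i * MvPolynomial.pderiv i Ψ) := by
  rw [MvPolynomial.pderiv_map, map_mul, MvPolynomial.map_X]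

/-- The bordered log-Hessian commutes with specialising the parameter. [folklore] -/
theorem logH_map {A : Type*} [CommRing A] (Φh : MvPolynomial (Fin 2) A) (φ : A →+* ℝ) :
    (MvPolynomial.X 0 * MvPolynomial.pderiv 0 (MvPolynomial.X 0 * MvPolynomial.pderiv 0 ((MvPolynomial.map φ Φh))) * (MvPolynomial.X 1 * MvPolynomial.pderiv 1 ((MvPolynomial.map φ Φh))) ^ 2 - 2 * (MvPolynomial.X 0 * MvPolynomial.pderiv 0 (MvPolynomial.X 1 * MvPolynomial.pderiv 1 ((MvPolynomial.map φ Φh)))) * (MvPolynomial.X 0 * MvPolynomial.pderiv 0 ((MvPolynomial.map φ Φh))) * (MvPolynomial.X 1 * MvPolynomial.pderiv 1 ((MvPolynomial.map φ Φh))) + MvPolynomial.X 1 * MvPolynomial.pderiv 1 (MvPolynomial.X 1 * MvPolynomial.pderiv 1 ((MvPolynomial.map φ Φh))) * (MvPolynomial.X 0 * MvPolynomial.pderiv 0 ((MvPolynomial.map φ Φh))) ^ 2) =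
      MvPolynomial.map φ (MvPolynomial.X 0 * MvPolynomial.pderiv 0 (MvPolynomial.X 0 * MvPolynomial.pderiv 0 (Φh)) * (MvPolynomial.X 1 * MvPolynomial.pderiv 1 (Φh)) ^ 2 - 2 * (MvPolynomial.X 0 * MvPolynomial.pderiv 0 (MvPolynomial.X 1 * MvPolynomial.pderiv 1 (Φh))) * (MvPolynomial.X 0 * MvPolynomial.pderiv 0 (Φh)) * (MvPolynomial.X 1 * MvPolynomial.pderiv 1 (Φh)) + MvPolynomial.X 1 * MvPolynomial.pderiv 1 (MvPolynomial.X 1 * MvPolynomial.pderiv 1 (Φh)) * (MvPolynomial.X 0 * MvPolynomial.pderiv 0 (Φh)) ^ 2) := by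
  rw [euler_map Φh φ 0, euler_map Φh φ 1, euler_map, euler_map, euler_map]
  simp only [map_mul, map_pow, map_sub, map_add, map_ofNat]

/-! ### Formal versus actual degrees of a resultant; finitely many bad parameters -/

/-- If the formal resultant (degrees `N ≥ deg f`, `M ≥ deg g`) is nonzero then so is the resultant. [folklore] -/
theorem resultant_ne_zero_of_formal {R : Type*} [CommRing R] (f g : R[X]) (N M : ℕ) (hN : f.natDegree ≤ N)
    (hM : g.natDegree ≤ M) (h : resultant f g N M ≠ 0) : resultant f g ≠ 0 := by
  intro h0
  apply h
  obtain ⟨k, hk⟩ := Nat.exists_eq_add_of_le hN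
  obtain ⟨j, hj⟩ := Nat.exists_eq_add_of_le hM
  rw [hk, resultant_add_left_deg (f := f) (g := g) (m := f.natDegree) (n := M) (k := k) le_rfl, hj,
    resultant_add_right_deg (f := f) (g := g) (m := f.natDegree) (n := g.natDegree) j le_rfl]
  rw [show resultant f g f.natDegree g.natDegree = resultant f g from rfl, h0]
  ring

/-- Conversely, with EXACT degree `N` of `f` (over a domain): the resultant nonzero ⇒ the formal resultant nonzero.
[folklore] -/
theorem resultant_formal_ne_zero {R : Type*} [CommRing R] [IsDomain R] (f g : R[X]) (N M : ℕ)
    (htop : f.coeff N ≠ 0) (hN : f.natDegree ≤ N) (hM : g.natDegree ≤ M) (h : resultant f g ≠ 0) :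
    resultant f g N M ≠ 0 := by
  have hdeg : f.natDegree = N := le_antisymm hN (le_natDegree_of_ne_zero htop)
  obtain ⟨j, hj⟩ := Nat.exists_eq_add_of_le hM
  rw [← hdeg, hj, resultant_add_right_deg (f := f) (g := g) (m := f.natDegree) (n := g.natDegree) j le_rfl]
  refine mul_ne_zero (pow_ne_zero _ ?_) h
  rw [hdeg]; exact htop

/-- A nonzero `R ∈ ℝ[ε][t]` vanishes identically in `t` for at most finitely many `ε`. [folklore] -/
theorem finite_setOf_map_eval_eq_zero (R : ℝ[X][X]) (hR : R ≠ 0) :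
    {ε : ℝ | R.map (evalRingHom ε) = 0}.Finite := by
  obtain ⟨j, hj⟩ : ∃ j, R.coeff j ≠ 0 := by
    by_contra h
    push Not at h
    exact hR (Polynomial.ext fun j => by rw [h j, coeff_zero])
  refine (Polynomial.finite_setOf_isRoot hj).subset fun ε hε => ?_
  have := congr_arg (fun q : ℝ[X] => q.coeff j) hε
  simp only [coeff_map, coe_evalRingHom, coeff_zero] at this
  exact this

/-! ### The genericity theorem -/

/-- **Finitely many bad parameters for the resultant criterion.**  See the module docstring. [folklore] -/
theorem finite_bad_eps_resultant (Φh : MvPolynomial (Fin 2) ℝ[X]) (N M : ℕ)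
    (hN : (MvPolynomial.aeval (![Polynomial.C Polynomial.X, Polynomial.X] : Fin 2 → ℝ[X][X][X]) Φh).natDegree ≤ N)
    (hM : (MvPolynomial.aeval (![Polynomial.C Polynomial.X, Polynomial.X] : Fin 2 → ℝ[X][X][X]) (MvPolynomial.X 0 * MvPolynomial.pderiv 0 (MvPolynomial.X 0 * MvPolynomial.pderiv 0 (Φh)) * (MvPolynomial.X 1 * MvPolynomial.pderiv 1 (Φh)) ^ 2 - 2 * (MvPolynomial.X 0 * MvPolynomial.pderiv 0 (MvPolynomial.X 1 * MvPolynomial.pderiv 1 (Φh))) * (MvPolynomial.X 0 * MvPolynomial.pderiv 0 (Φh)) * (MvPolynomial.X 1 * MvPolynomial.pderiv 1 (Φh)) + MvPolynomial.X 1 * MvPolynomial.pderiv 1 (MvPolynomial.X 1 * MvPolynomial.pderiv 1 (Φh)) * (MvPolynomial.X 0 * MvPolynomial.pderiv 0 (Φh)) ^ 2)).natDegree ≤ M)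
    (ε₁ : ℝ) (htop : (MvPolynomial.aeval (![Polynomial.C Polynomial.X, Polynomial.X] : Fin 2 → ℝ[X][X]) (MvPolynomial.map (Polynomial.evalRingHom ε₁) Φh)).coeff N ≠ 0)
    (hres₁ : resultant (MvPolynomial.aeval (![Polynomial.C Polynomial.X, Polynomial.X] : Fin 2 → ℝ[X][X]) (MvPolynomial.map (Polynomial.evalRingHom ε₁) Φh))
      (MvPolynomial.aeval (![Polynomial.C Polynomial.X, Polynomial.X] : Fin 2 → ℝ[X][X]) (MvPolynomial.X 0 * MvPolynomial.pderiv 0 (MvPolynomial.X 0 * MvPolynomial.pderiv 0 ((MvPolynomial.map (Polynomial.evalRingHom ε₁) Φh))) * (MvPolynomial.X 1 * MvPolynomial.pderiv 1 ((MvPolynomial.map (Polynomial.evalRingHom ε₁) Φh))) ^ 2 - 2 * (MvPolynomial.X 0 * MvPolynomial.pderiv 0 (MvPolynomial.X 1 * MvPolynomial.pderiv 1 ((MvPolynomial.map (Polynomial.evalRingHom ε₁) Φh)))) * (MvPolynomial.X 0 * MvPolynomial.pderiv 0 ((MvPolynomial.map (Polynomial.evalRingHom ε₁) Φh))) * (MvPolynomial.X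 1 * MvPolynomial.pderiv 1 ((MvPolynomial.map (Polynomial.evalRingHom ε₁) Φh))) + MvPolynomial.X 1 * MvPolynomial.pderiv 1 (MvPolynomial.X 1 * MvPolynomial.pderiv 1 ((MvPolynomial.map (Polynomial.evalRingHom ε₁) Φh))) * (MvPolynomial.X 0 * MvPolynomial.pderiv 0 ((MvPolynomial.map (Polynomial.evalRingHom ε₁) Φh))) ^ 2)) ≠ 0) :
    {ε : ℝ | resultant (MvPolynomial.aeval (![Polynomial.C Polynomial.X, Polynomial.X] : Fin 2 → ℝ[X][X]) (MvPolynomial.map (Polynomial.evalRingHom ε) Φh))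
      (MvPolynomial.aeval (![Polynomial.C Polynomial.X, Polynomial.X] : Fin 2 → ℝ[X][X]) (MvPolynomial.X 0 * MvPolynomial.pderiv 0 (MvPolynomial.X 0 * MvPolynomial.pderiv 0 ((MvPolynomial.map (Polynomial.evalRingHom ε) Φh))) * (MvPolynomial.X 1 * MvPolynomial.pderiv 1 ((MvPolynomial.map (Polynomial.evalRingHom ε) Φh))) ^ 2 - 2 * (MvPolynomial.X 0 * MvPolynomial.pderiv 0 (MvPolynomial.X 1 * MvPolynomial.pderiv 1 ((MvPolynomial.map (Polynomial.evalRingHom ε) Φh)))) * (MvPolynomial.X 0 * MvPolynomial.pderiv 0 ((MvPolynomial.map (Polynomial.evalRingHom ε) Φh))) * (MvPolynomial.X 1 * MvPolynomial.pderiv 1 ((MvPolynomial.map (Polynomial.evalRingHom ε) Φh))) + MvPolynomial.X 1 * MvPolynomial.pderiv 1 (MvPolynomial.X 1 * MvPolynomial.pderiv 1 ((MvPolynomial.map (Polynomial.evalRingHom ε) Φh))) * (MvPolynomial.X 0 * MvPolynomial.pderiv 0 ((MvPolynomial.map (Polynomial.evalRingHom ε) Φh))) ^ 2)) = 0}.Finite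 := by
  -- the master resultant over `ℝ[ε]`
  set Rh : ℝ[X][X] := resultant (MvPolynomial.aeval (![Polynomial.C Polynomial.X, Polynomial.X] : Fin 2 → ℝ[X][X][X]) Φh)
    (MvPolynomial.aeval (![Polynomial.C Polynomial.X, Polynomial.X] : Fin 2 → ℝ[X][X][X]) (MvPolynomial.X 0 * MvPolynomial.pderiv 0 (MvPolynomial.X 0 * MvPolynomial.pderiv 0 (Φh)) * (MvPolynomial.X 1 * MvPolynomial.pderiv 1 (Φh)) ^ 2 - 2 * (MvPolynomial.X 0 * MvPolynomial.pderiv 0 (MvPolynomial.X 1 * MvPolynomial.pderiv 1 (Φh))) * (MvPolynomial.X 0 * MvPolynomial.pderiv 0 (Φh)) * (MvPolynomial.X 1 * MvPolynomial.pderiv 1 (Φh)) + MvPolynomial.X 1 * MvPolynomial.pderiv 1 (MvPolynomial.X 1 * MvPolynomial.pderiv 1 (Φh)) * (MvPolynomial.X 0 * MvPolynomial.pderiv 0 (Φh)) ^ 2)) N M with hRh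
  -- its specialisations are the formal resultants of the specialised curves
  have hspec : ∀ ε : ℝ, Rh.map (evalRingHom ε) =
      resultant (MvPolynomial.aeval (![Polynomial.C Polynomial.X, Polynomial.X] : Fin 2 → ℝ[X][X]) (MvPolynomial.map (Polynomial.evalRingHom ε) Φh))
        (MvPolynomial.aeval (![Polynomial.C Polynomial.X, Polynomial.X] : Fin 2 → ℝ[X][X]) (MvPolynomial.X 0 * MvPolynomial.pderiv 0 (MvPolynomial.X 0 * MvPolynomial.pderiv 0 ((MvPolynomial.map (Polynomial.evalRingHom ε) Φh))) * (MvPolynomial.X 1 * MvPolynomial.pderiv 1 ((MvPolynomial.map (Polynomial.evalRingHom ε) Φh))) ^ 2 - 2 * (MvPolynomial.X 0 * MvPolynomial.pderiv 0 (MvPolynomial.X 1 * MvPolynomial.pderiv 1 ((MvPolynomial.map (Polynomial.evalRingHom ε) Φh)))) * (MvPolynomial.X 0 * MvPolynomial.pderiv 0 ((MvPolynomial.map (Polynomial.evalRingHom ε) Φh))) * (MvPolynomial.X 1 * MvPolynomial.pderiv 1 ((MvPolynomial.map (Polynomial.evalRingHom ε) Φh))) + MvPolynomial.X 1 * MvPolynomial.pderiv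 1 (MvPolynomial.X 1 * MvPolynomial.pderiv 1 ((MvPolynomial.map (Polynomial.evalRingHom ε) Φh))) * (MvPolynomial.X 0 * MvPolynomial.pderiv 0 ((MvPolynomial.map (Polynomial.evalRingHom ε) Φh))) ^ 2)) N M := by
    intro ε
    rw [logH_map, toBiv_map, toBiv_map, hRh, ← coe_mapRingHom, ← resultant_map_map]
  -- degree bounds at every parameter
  have hNε : ∀ ε : ℝ, (MvPolynomial.aeval (![Polynomial.C Polynomial.X, Polynomial.X] : Fin 2 → ℝ[X][X]) (MvPolynomial.map (Polynomial.evalRingHom ε) Φh)).natDegree ≤ N := by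
    intro ε; rw [toBiv_map]; exact natDegree_map_le.trans hN
  have hMε : ∀ ε : ℝ, (MvPolynomial.aeval (![Polynomial.C Polynomial.X, Polynomial.X] : Fin 2 → ℝ[X][X]) (MvPolynomial.X 0 * MvPolynomial.pderiv 0 (MvPolynomial.X 0 * MvPolynomial.pderiv 0 ((MvPolynomial.map (Polynomial.evalRingHom ε) Φh))) * (MvPolynomial.X 1 * MvPolynomial.pderiv 1 ((MvPolynomial.map (Polynomial.evalRingHom ε) Φh))) ^ 2 - 2 * (MvPolynomial.X 0 * MvPolynomial.pderiv 0 (MvPolynomial.X 1 * MvPolynomial.pderiv 1 ((MvPolynomial.map (Polynomial.evalRingHom ε) Φh)))) * (MvPolynomial.X 0 * MvPolynomial.pderiv 0 ((MvPolynomial.map (Polynomial.evalRingHom ε) Φh))) * (MvPolynomial.X 1 * MvPolynomial.pderiv 1 ((MvPolynomial.map (Polynomial.evalRingHom ε) Φh))) + MvPolynomial.X 1 * MvPolynomial.pderiv 1 (MvPolynomial.X 1 * MvPolynomial.pderiv 1 ((MvPolynomial.map (Polynomial.evalRingHom ε) Φh))) * (MvPolynomial.X 0 * MvPolynomial.pderiv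 0 ((MvPolynomial.map (Polynomial.evalRingHom ε) Φh))) ^ 2)).natDegree ≤ M := by
    intro ε; rw [logH_map, toBiv_map]; exact natDegree_map_le.trans hM
  -- `Rh ≠ 0` from the good parameter `ε₁`
  have hRh0 : Rh ≠ 0 := by
    intro h0
    have h1 := hspec ε₁
    rw [h0, Polynomial.map_zero] at h1
    exact resultant_formal_ne_zero _ _ N M htop (hNε ε₁) (hMε ε₁) hres₁ h1.symm
  refine (finite_setOf_map_eval_eq_zero Rh hRh0).subset fun ε hε => ?_
  rw [Set.mem_setOf_eq] at hε ⊢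
  by_contra hne
  exact resultant_ne_zero_of_formal _ _ N M (hNε ε) (hMε ε) (by rw [← hspec ε]; exact hne) hε

/-- **Corollary: finiteness of the osculation-type set for all but finitely many parameters** (with part 8): outside a
finite set of `ε`, either some fibre `Φ_ε(t,·)` (`t > 0`) vanishes identically or `{Φ_ε = 0, H(Φ_ε) = 0} ∩ quadrant` is finite.
[folklore] -/
theorem finite_bad_eps_osc (Φh : MvPolynomial (Fin 2) ℝ[X]) (N M : ℕ)
    (hN : (MvPolynomial.aeval (![Polynomial.C Polynomial.X, Polynomial.X] : Fin 2 → ℝ[X][X][X]) Φh).natDegree ≤ N)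
    (hM : (MvPolynomial.aeval (![Polynomial.C Polynomial.X, Polynomial.X] : Fin 2 → ℝ[X][X][X]) (MvPolynomial.X 0 * MvPolynomial.pderiv 0 (MvPolynomial.X 0 * MvPolynomial.pderiv 0 (Φh)) * (MvPolynomial.X 1 * MvPolynomial.pderiv 1 (Φh)) ^ 2 - 2 * (MvPolynomial.X 0 * MvPolynomial.pderiv 0 (MvPolynomial.X 1 * MvPolynomial.pderiv 1 (Φh))) * (MvPolynomial.X 0 * MvPolynomial.pderiv 0 (Φh)) * (MvPolynomial.X 1 * MvPolynomial.pderiv 1 (Φh)) + MvPolynomial.X 1 * MvPolynomial.pderiv 1 (MvPolynomial.X 1 * MvPolynomial.pderiv 1 (Φh)) * (MvPolynomial.X 0 * MvPolynomial.pderiv 0 (Φh)) ^ 2)).natDegree ≤ M)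
    (ε₁ : ℝ) (htop : (MvPolynomial.aeval (![Polynomial.C Polynomial.X, Polynomial.X] : Fin 2 → ℝ[X][X]) (MvPolynomial.map (Polynomial.evalRingHom ε₁) Φh)).coeff N ≠ 0)
    (hres₁ : resultant (MvPolynomial.aeval (![Polynomial.C Polynomial.X, Polynomial.X] : Fin 2 → ℝ[X][X]) (MvPolynomial.map (Polynomial.evalRingHom ε₁) Φh))
      (MvPolynomial.aeval (![Polynomial.C Polynomial.X, Polynomial.X] : Fin 2 → ℝ[X][X]) (MvPolynomial.X 0 * MvPolynomial.pderiv 0 (MvPolynomial.X 0 * MvPolynomial.pderiv 0 ((MvPolynomial.map (Polynomial.evalRingHom ε₁) Φh))) * (MvPolynomial.X 1 * MvPolynomial.pderiv 1 ((MvPolynomial.map (Polynomial.evalRingHom ε₁) Φh))) ^ 2 - 2 * (MvPolynomial.X 0 * MvPolynomial.pderiv 0 (MvPolynomial.X 1 * MvPolynomial.pderiv 1 ((MvPolynomial.map (Polynomial.evalRingHom ε₁) Φh)))) * (MvPolynomial.X 0 * MvPolynomial.pderiv 0 ((MvPolynomial.map (Polynomial.evalRingHom ε₁) Φh))) * (MvPolynomial.X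 1 * MvPolynomial.pderiv 1 ((MvPolynomial.map (Polynomial.evalRingHom ε₁) Φh))) + MvPolynomial.X 1 * MvPolynomial.pderiv 1 (MvPolynomial.X 1 * MvPolynomial.pderiv 1 ((MvPolynomial.map (Polynomial.evalRingHom ε₁) Φh))) * (MvPolynomial.X 0 * MvPolynomial.pderiv 0 ((MvPolynomial.map (Polynomial.evalRingHom ε₁) Φh))) ^ 2)) ≠ 0) :
    ∃ B : Set ℝ, B.Finite ∧ ∀ ε : ℝ, ε ∉ B →
      (∀ t : ℝ, 0 < t → (MvPolynomial.aeval (![Polynomial.C Polynomial.X, Polynomial.X] : Fin 2 → ℝ[X][X]) (MvPolynomial.map (Polynomial.evalRingHom ε) Φh)).map (evalRingHom t) ≠ 0) →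
      {p : Fin 2 → ℝ | 0 < p 0 ∧ 0 < p 1 ∧ MvPolynomial.eval p (MvPolynomial.map (Polynomial.evalRingHom ε) Φh) = 0 ∧
        MvPolynomial.eval p (MvPolynomial.X 0 * MvPolynomial.pderiv 0 (MvPolynomial.X 0 * MvPolynomial.pderiv 0 ((MvPolynomial.map (Polynomial.evalRingHom ε) Φh))) * (MvPolynomial.X 1 * MvPolynomial.pderiv 1 ((MvPolynomial.map (Polynomial.evalRingHom ε) Φh))) ^ 2 - 2 * (MvPolynomial.X 0 * MvPolynomial.pderiv 0 (MvPolynomial.X 1 * MvPolynomial.pderiv 1 ((MvPolynomial.map (Polynomial.evalRingHom ε) Φh)))) * (MvPolynomial.X 0 * MvPolynomial.pderiv 0 ((MvPolynomial.map (Polynomial.evalRingHom ε) Φh))) * (MvPolynomial.X 1 * MvPolynomial.pderiv 1 ((MvPolynomial.map (Polynomial.evalRingHom ε) Φh))) + MvPolynomial.X 1 * MvPolynomial.pderiv 1 (MvPolynomial.X 1 * MvPolynomial.pderiv 1 ((MvPolynomial.map (Polynomial.evalRingHom ε) Φh))) * (MvPolynomial.X 0 * MvPolynomial.pderiv 0 ((MvPolynomial.map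 (Polynomial.evalRingHom ε) Φh))) ^ 2) = 0}.Finite := by
  refine ⟨_, finite_bad_eps_resultant Φh N M hN hM ε₁ htop hres₁, fun ε hε hvert => ?_⟩
  rw [Set.mem_setOf_eq] at hε
  exact mv_osc_finite_of_resultant_ne_zero _ hε hvert

/-! ### The witness side: a resultant is nonzero as soon as ONE good fibre has no common root -/

/-- Over `ℝ`: a nonzero polynomial that SPLITS and shares no root with `g` is coprime to `g` (every common factor would
split and contribute a common root). [folklore] -/
theorem isCoprime_of_splits_of_no_common_root {f g : ℝ[X]} (hf0 : f ≠ 0) (hf : f.Splits)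
    (h : ∀ x : ℝ, f.IsRoot x → ¬ g.IsRoot x) : IsCoprime f g := by
  refine isCoprime_of_dvd f g (fun h0 => hf0 h0.1) fun z hzu hz0 hzf hzg => ?_
  have hzs : z.Splits := hf.of_dvd hf0 hzf
  have hdeg : z.degree ≠ 0 := fun hd => hzu (isUnit_iff_degree_eq_zero.2 hd)
  obtain ⟨x, hx⟩ := hzs.exists_eval_eq_zero hdeg
  exact h x (IsRoot.dvd (IsRoot.def.2 hx) hzf) (IsRoot.dvd (IsRoot.def.2 hx) hzg)

/-- A resultant of two real polynomials is nonzero when the first splits and they share no root. [folklore] -/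
theorem resultant_ne_zero_of_splits {f g : ℝ[X]} (hf0 : f ≠ 0) (hf : f.Splits)
    (h : ∀ x : ℝ, f.IsRoot x → ¬ g.IsRoot x) : resultant f g ≠ 0 := fun h0 =>
  (resultant_eq_zero_iff.1 h0).2 (isCoprime_of_splits_of_no_common_root hf0 hf h)

/-- **Bivariate lift**: `Res_b(P, Q) ≢ 0` in `ℝ[t]` as soon as at ONE abscissa `t₀` the leading `b`-coefficient of `P`
survives, `P(t₀,·)` splits and `P(t₀,·)`, `Q(t₀,·)` have no common root (the shape in which an explicit general-position
WITNESS is checked). [cite: GathenGerhard1999, Lemma 6.25] -/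
theorem resultant_ne_zero_of_fibre (P Q : ℝ[X][X]) (t₀ : ℝ) (hlc : P.leadingCoeff.eval t₀ ≠ 0)
    (hsplit : (P.map (evalRingHom t₀)).Splits)
    (h : ∀ b : ℝ, (P.map (evalRingHom t₀)).IsRoot b → ¬ (Q.map (evalRingHom t₀)).IsRoot b) :
    resultant P Q ≠ 0 := by
  intro h0
  have hP : P.map (evalRingHom t₀) ≠ 0 := map_ne_zero_of_eval_leadingCoeff hlc
  have hnc := (Literature.Algebra.Polynomial.ModularGcd.map_resultant_eq_zero_iff_not_isCoprime (evalRingHom t₀) P Q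
    (Or.inl hlc)).1 (by rw [h0, map_zero])
  exact hnc (isCoprime_of_splits_of_no_common_root hP hsplit h)

/-- The same with the leading coefficient presented as `coeff N` under a degree bound (convenient when the `b`-degree
of the curve is known in advance, e.g. `N = m` for `det(G(t) + b·B)`, `det B ≠ 0`). [folklore] -/
theorem resultant_ne_zero_of_fibre' (P Q : ℝ[X][X]) (N : ℕ) (hN : P.natDegree ≤ N) (t₀ : ℝ)
    (htop : (P.coeff N).eval t₀ ≠ 0) (hsplit : (P.map (evalRingHom t₀)).Splits)
    (h : ∀ b : ℝ, (P.map (evalRingHom t₀)).IsRoot b → ¬ (Q.map (evalRingHom t₀)).IsRoot b) :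
    resultant P Q ≠ 0 := by
  have hcN : P.coeff N ≠ 0 := fun h0 => htop (by rw [h0, eval_zero])
  have hdeg : P.natDegree = N := le_antisymm hN (le_natDegree_of_ne_zero hcN)
  refine resultant_ne_zero_of_fibre P Q t₀ ?_ hsplit h
  rw [leadingCoeff, hdeg]; exact htop

/-! ### Degree bounds: `H` at most triples the `b`-degree -/

section degrees

variable {R : Type*} [CommRing R]

/-- `toBiv (∂₁ Ψ)` is the `b`-derivative of `toBiv Ψ`. [folklore] -/
theorem toBiv_pderiv_one (Ψ : MvPolynomial (Fin 2) R) :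
    MvPolynomial.aeval (![Polynomial.C Polynomial.X, Polynomial.X] : Fin 2 → R[X][X]) (MvPolynomial.pderiv 1 Ψ) = derivative (MvPolynomial.aeval (![Polynomial.C Polynomial.X, Polynomial.X] : Fin 2 → R[X][X]) Ψ) := by
  induction Ψ using MvPolynomial.induction_on with
  | C a =>
    rw [MvPolynomial.pderiv_C, map_zero, MvPolynomial.algHom_C, Polynomial.algebraMap_apply, Polynomial.algebraMap_eq,
      derivative_C]
  | add p q hp hq => simp only [map_add, hp, hq]
  | mul_X p i hp =>
    rw [Derivation.leibniz, smul_eq_mul, smul_eq_mul, map_add, map_mul, map_mul, hp, map_mul, derivative_mul]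
    fin_cases i
    · simp only [Fin.zero_eta, Fin.isValue, MvPolynomial.pderiv_X_of_ne (show (0 : Fin 2) ≠ 1 by decide), map_zero,
        mul_zero, zero_add, MvPolynomial.aeval_X, Matrix.cons_val_zero, derivative_C, add_zero]
      ring
    · simp only [Fin.mk_one, Fin.isValue, MvPolynomial.pderiv_X_self, map_one, mul_one, MvPolynomial.aeval_X,
        Matrix.cons_val_one, Matrix.cons_val_zero, derivative_X]
      ring

/-- The `b`-coefficients of `toBiv (∂₀ Ψ)` are the `t`-derivatives of those of `toBiv Ψ`. [folklore] -/
theorem coeff_toBiv_pderiv_zero (Ψ : MvPolynomial (Fin 2) R) (k : ℕ) :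
    (MvPolynomial.aeval (![Polynomial.C Polynomial.X, Polynomial.X] : Fin 2 → R[X][X]) (MvPolynomial.pderiv 0 Ψ)).coeff k = derivative ((MvPolynomial.aeval (![Polynomial.C Polynomial.X, Polynomial.X] : Fin 2 → R[X][X]) Ψ).coeff k) := by
  induction Ψ using MvPolynomial.induction_on generalizing k with
  | C a =>
    rw [MvPolynomial.pderiv_C, map_zero, coeff_zero, MvPolynomial.algHom_C, Polynomial.algebraMap_apply,
      Polynomial.algebraMap_eq, coeff_C]
    split_ifs
    · rw [derivative_C]
    · rw [derivative_zero]
  | add p q hp hq => simp only [map_add, coeff_add, hp, hq]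
  | mul_X p i hp =>
    rw [Derivation.leibniz, smul_eq_mul, smul_eq_mul, map_add, map_mul, map_mul, map_mul]
    fin_cases i
    · simp only [Fin.zero_eta, Fin.isValue, MvPolynomial.pderiv_X_self, map_one, mul_one, MvPolynomial.aeval_X,
        Matrix.cons_val_zero, coeff_add, coeff_C_mul, coeff_mul_C, hp]
      rw [derivative_mul, derivative_X]
      ring
    · simp only [Fin.mk_one, Fin.isValue, MvPolynomial.pderiv_X_of_ne (show (1 : Fin 2) ≠ 0 by decide), map_zero,
        mul_zero, zero_add, MvPolynomial.aeval_X, Matrix.cons_val_one, Matrix.cons_val_zero]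
      cases k with
      | zero => rw [coeff_X_mul_zero, mul_comm, coeff_X_mul_zero, derivative_zero]
      | succ k => rw [coeff_X_mul, mul_comm, coeff_X_mul, hp]

variable [IsDomain R]

/-- `θ_i` does not raise the `b`-degree. [folklore] -/
theorem natDegree_toBiv_euler_le (i : Fin 2) (Ψ : MvPolynomial (Fin 2) R) :
    (MvPolynomial.aeval (![Polynomial.C Polynomial.X, Polynomial.X] : Fin 2 → R[X][X]) (MvPolynomial.X i * MvPolynomial.pderiv i Ψ)).natDegree ≤ (MvPolynomial.aeval (![Polynomial.C Polynomial.X, Polynomial.X] : Fin 2 → R[X][X]) Ψ).natDegree := by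
  fin_cases i
  · simp only [Fin.zero_eta, Fin.isValue, map_mul, MvPolynomial.aeval_X, Matrix.cons_val_zero]
    refine (natDegree_C_mul_le _ _).trans ?_
    rw [natDegree_le_iff_coeff_eq_zero]
    intro k hk
    rw [coeff_toBiv_pderiv_zero, coeff_eq_zero_of_natDegree_lt (by exact_mod_cast hk), derivative_zero]
  · simp only [Fin.mk_one, Fin.isValue, map_mul, MvPolynomial.aeval_X, Matrix.cons_val_one, Matrix.cons_val_zero,
      toBiv_pderiv_one]
    rcases eq_or_ne (derivative (MvPolynomial.aeval (![Polynomial.C Polynomial.X, Polynomial.X] : Fin 2 → R[X][X]) Ψ)) 0 with h0 | h0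
    · rw [h0, mul_zero, natDegree_zero]; exact Nat.zero_le _
    · rw [natDegree_X_mul h0]
      have hne : (MvPolynomial.aeval (![Polynomial.C Polynomial.X, Polynomial.X] : Fin 2 → R[X][X]) Ψ).natDegree ≠ 0 := by
        intro h
        exact h0 (derivative_of_natDegree_zero h)
      have := natDegree_derivative_lt hne
      omega

omit [IsDomain R] in
/-- Degree of the Hessian shape. [folklore] -/
theorem natDegree_shape_le (a b c d e : R[X]) (n : ℕ) (ha : a.natDegree ≤ n) (hb : b.natDegree ≤ n)
    (hc : c.natDegree ≤ n) (hd : d.natDegree ≤ n) (he : e.natDegree ≤ n) :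
    (a * b ^ 2 - 2 * c * d * b + e * d ^ 2).natDegree ≤ 3 * n := by
  have hb2 : (b ^ 2).natDegree ≤ 2 * n := natDegree_pow_le.trans (by omega)
  have hd2 : (d ^ 2).natDegree ≤ 2 * n := natDegree_pow_le.trans (by omega)
  have t1 : (a * b ^ 2).natDegree ≤ 3 * n := natDegree_mul_le.trans (by omega)
  have t2a : ((2 : R[X]) * c).natDegree ≤ n := by
    rw [two_mul]; exact (natDegree_add_le _ _).trans (max_le hc hc)
  have t2b : ((2 : R[X]) * c * d).natDegree ≤ 2 * n := natDegree_mul_le.trans (by omega)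
  have t2 : ((2 : R[X]) * c * d * b).natDegree ≤ 3 * n := natDegree_mul_le.trans (by omega)
  have t3 : (e * d ^ 2).natDegree ≤ 3 * n := natDegree_mul_le.trans (by omega)
  refine (natDegree_add_le _ _).trans (max_le ((natDegree_sub_le _ _).trans (max_le t1 t2)) t3)

/-- **`deg_b H(Ψ) ≤ 3 · deg_b Ψ`.** [folklore] -/
theorem natDegree_toBiv_logH_le (Ψ : MvPolynomial (Fin 2) R) :
    (MvPolynomial.aeval (![Polynomial.C Polynomial.X, Polynomial.X] : Fin 2 → R[X][X])
        (MvPolynomial.X 0 * MvPolynomial.pderiv 0 (MvPolynomial.X 0 * MvPolynomial.pderiv 0 Ψ)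
            * (MvPolynomial.X 1 * MvPolynomial.pderiv 1 Ψ) ^ 2
          - 2 * (MvPolynomial.X 0 * MvPolynomial.pderiv 0 (MvPolynomial.X 1 * MvPolynomial.pderiv 1 Ψ))
            * (MvPolynomial.X 0 * MvPolynomial.pderiv 0 Ψ) * (MvPolynomial.X 1 * MvPolynomial.pderiv 1 Ψ)
          + MvPolynomial.X 1 * MvPolynomial.pderiv 1 (MvPolynomial.X 1 * MvPolynomial.pderiv 1 Ψ)
            * (MvPolynomial.X 0 * MvPolynomial.pderiv 0 Ψ) ^ 2)).natDegree ≤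
      3 * (MvPolynomial.aeval (![Polynomial.C Polynomial.X, Polynomial.X] : Fin 2 → R[X][X]) Ψ).natDegree := by
  have hshape : MvPolynomial.aeval (![Polynomial.C Polynomial.X, Polynomial.X] : Fin 2 → R[X][X])
        (MvPolynomial.X 0 * MvPolynomial.pderiv 0 (MvPolynomial.X 0 * MvPolynomial.pderiv 0 Ψ)
            * (MvPolynomial.X 1 * MvPolynomial.pderiv 1 Ψ) ^ 2
          - 2 * (MvPolynomial.X 0 * MvPolynomial.pderiv 0 (MvPolynomial.X 1 * MvPolynomial.pderiv 1 Ψ))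
            * (MvPolynomial.X 0 * MvPolynomial.pderiv 0 Ψ) * (MvPolynomial.X 1 * MvPolynomial.pderiv 1 Ψ)
          + MvPolynomial.X 1 * MvPolynomial.pderiv 1 (MvPolynomial.X 1 * MvPolynomial.pderiv 1 Ψ)
            * (MvPolynomial.X 0 * MvPolynomial.pderiv 0 Ψ) ^ 2) =
      MvPolynomial.aeval (![Polynomial.C Polynomial.X, Polynomial.X] : Fin 2 → R[X][X]) (MvPolynomial.X 0 * MvPolynomial.pderiv 0 (MvPolynomial.X 0 * MvPolynomial.pderiv 0 Ψ)) *
          MvPolynomial.aeval (![Polynomial.C Polynomial.X, Polynomial.X] : Fin 2 → R[X][X]) (MvPolynomial.X 1 * MvPolynomial.pderiv 1 Ψ) ^ 2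
        - 2 * MvPolynomial.aeval (![Polynomial.C Polynomial.X, Polynomial.X] : Fin 2 → R[X][X]) (MvPolynomial.X 0 * MvPolynomial.pderiv 0 (MvPolynomial.X 1 * MvPolynomial.pderiv 1 Ψ)) *
          MvPolynomial.aeval (![Polynomial.C Polynomial.X, Polynomial.X] : Fin 2 → R[X][X]) (MvPolynomial.X 0 * MvPolynomial.pderiv 0 Ψ) *
          MvPolynomial.aeval (![Polynomial.C Polynomial.X, Polynomial.X] : Fin 2 → R[X][X]) (MvPolynomial.X 1 * MvPolynomial.pderiv 1 Ψ)
        + MvPolynomial.aeval (![Polynomial.C Polynomial.X, Polynomial.X] : Fin 2 → R[X][X]) (MvPolynomial.X 1 * MvPolynomial.pderiv 1 (MvPolynomial.X 1 * MvPolynomial.pderiv 1 Ψ)) *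
          MvPolynomial.aeval (![Polynomial.C Polynomial.X, Polynomial.X] : Fin 2 → R[X][X]) (MvPolynomial.X 0 * MvPolynomial.pderiv 0 Ψ) ^ 2 := by
    simp only [map_add, map_sub, map_mul, map_pow, map_ofNat]
  rw [hshape]
  exact natDegree_shape_le _ _ _ _ _ _ ((natDegree_toBiv_euler_le 0 _).trans (natDegree_toBiv_euler_le 0 Ψ))
    (natDegree_toBiv_euler_le 1 Ψ) ((natDegree_toBiv_euler_le 0 _).trans (natDegree_toBiv_euler_le 1 Ψ))
    (natDegree_toBiv_euler_le 0 Ψ) ((natDegree_toBiv_euler_le 1 _).trans (natDegree_toBiv_euler_le 1 Ψ))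

end degrees

end OsculationUniform

end Summit.ValiantsHypothesis.ValiantsHypothesis.Theorems.LacunarySymmetroidMatrixDescartes
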